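import Mathlib.Analysis.Calculus.FDeriv.Symmetric
import Summits.FinalStateConjecture.FinalStateConjecture.Theorems.EIHFluxBalanceInertialRecessionCalculus
import Summits.FinalStateConjecture.FinalStateConjecture.Theorems.EIHFluxBalanceModulatedKerrHandoffAnnulusRigidityMinkowskiNorm

/-!
# Route EIHFluxBalance — `ModulatedKerrHandoff`, stub `stub_annulusRigidity`: the Christoffel identity

Helper file for the crux `stmt-FinalStateConjecture-10167`
(`Summit.FinalStateConjecture.FinalStateConjecture.Theses.EIHFluxBalance.ModulatedKerrHandoff`),
line `overlap-modulation-second-iterate`, stub `stub_annulusRigidity` (rigidity of almost-isometric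
`C²` maps of a Minkowski annulus).

**Claim (`norm_fderiv_fderiv_le`).** Let `ψ : E4 → E4` be `C²` at `x`, `B = Dψ(x)` with `‖B‖ ≤ Γ`,
pulled-back form `g = η(B·, B·)` with `‖g − η‖ ≤ ε ≤ 1/2`, and `‖D(y ↦ η(Dψ(y)·, Dψ(y)·))(x)‖ ≤ δ`
(Euclidean operator norms). Then `‖D²ψ(x)‖ ≤ 3Γδ`.

**Proof.** The derivative of the pulled-back form on vectors is
`Dg(u)(v, w) = η(D²ψ(u, v), Bw) + η(Bv, D²ψ(u, w))` (`fderiv_bilinearComp_self_apply`; only VALUES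
are needed, obtained from the scalar functions `y ↦ η(Dψ(y)v, Dψ(y)w)` and uniqueness of the
derivative). With `T(u, v, w) = η(D²ψ(u, v), Bw)`, symmetric in `(u, v)` (`ψ ∈ C²`,
`ContDiffAt.isSymmSndFDerivAt`), the CHRISTOFFEL IDENTITY `2T(u,v,w) = Dg(u)(v,w) + Dg(v)(u,w) −
Dg(w)(u,v)` gives `|T| ≤ (3/2)δ‖u‖‖v‖‖w‖` (`abs_bilin_fderiv_apply_le`); testing against the
`B`-preimage `w` of `θ D²ψ(u,v)` (`exists_preimage_norm_le`: `(1 − ε)‖w‖ ≤ Γ‖D²ψ(u,v)‖`) yields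
`‖D²ψ(u,v)‖² = T(u,v,w) ≤ (3/2)δ‖u‖‖v‖ · 2Γ‖D²ψ(u,v)‖`. This is the classical argument that local
isometries of Minkowski space are affine (O'Neill 1983, Ch. 3, Prop. 3.62 ff.; Christoffel 1869),
made quantitative. [folklore]
-/

noncomputable section

-- `Summit.<S>.<S>.…` (single-problem summit, D-0017) trips core's duplicate-namespace linter.
set_option linter.dupNamespace false
-- the operator-norm instance path on trilinear-form-valued maps needs one more pending level
set_option maxSynthPendingDepth 3

open scoped Topology ContDiff
open Set Filter Literature.Geometry.Lorentzian Literature.Geometry.Lorentzian.KerrSchild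

namespace Summit.FinalStateConjecture.FinalStateConjecture.Theorems

namespace AnnulusRigidity

/-! ### The derivative of a pulled-back form on vectors -/

/-- `y ↦ η(f(y)·, f(y)·)` is differentiable at `x` when `f` is `C¹` at `x`. [folklore] -/
theorem differentiableAt_bilinearComp_self {f : E4 → E4 →L[ℝ] E4} {x : E4}
    (hf : ContDiffAt ℝ 1 f x) :
    DifferentiableAt ℝ (fun y ↦ Minkowski.bilin.bilinearComp (f y) (f y)) x :=
  ((contDiffWithinAt_bilinearComp_self contDiffWithinAt_const hf.contDiffWithinAt).contDiffAt
    univ_mem).differentiableAt one_ne_zero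

/-- Product rule for the scalar function `y ↦ η(a(y), b(y))`. [folklore] -/
theorem hasFDerivAt_bilin_apply₂ {a b : E4 → E4} {a' b' : E4 →L[ℝ] E4} {x : E4}
    (ha : HasFDerivAt a a' x) (hb : HasFDerivAt b b' x) :
    HasFDerivAt (fun y ↦ Minkowski.bilin (a y) (b y))
      ((Minkowski.bilin (a x)).comp b' +
        ((Minkowski.bilin : E4 →L[ℝ] E4 →L[ℝ] ℝ).comp a').flip (b x)) x :=
  ((Minkowski.bilin : E4 →L[ℝ] E4 →L[ℝ] ℝ).hasFDerivAt.comp x ha).clm_apply hb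

/-- **Derivative of the pulled-back form on vectors**: for `f` of class `C¹` at `x`,
`D(y ↦ η(f(y)·, f(y)·))(x)(u)(v, w) = η(Df(x)(u)(v), f(x)w) + η(f(x)v, Df(x)(u)(w))`. [folklore] -/
theorem fderiv_bilinearComp_self_apply {f : E4 → E4 →L[ℝ] E4} {x : E4}
    (hf : ContDiffAt ℝ 1 f x) (u v w : E4) :
    fderiv ℝ (fun y ↦ Minkowski.bilin.bilinearComp (f y) (f y)) x u v w =
      Minkowski.bilin (fderiv ℝ f x u v) (f x w) +
        Minkowski.bilin (f x v) (fderiv ℝ f x u w) := by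
  set G : E4 → E4 →L[ℝ] E4 →L[ℝ] ℝ := fun y ↦ Minkowski.bilin.bilinearComp (f y) (f y) with hG
  have hGd : HasFDerivAt G (fderiv ℝ G x) x := (differentiableAt_bilinearComp_self hf).hasFDerivAt
  have hfd : HasFDerivAt f (fderiv ℝ f x) x := (hf.differentiableAt one_ne_zero).hasFDerivAt
  have hv : HasFDerivAt (fun y ↦ f y v) ((fderiv ℝ f x).flip v) x := by
    simpa using hfd.clm_apply (hasFDerivAt_const v x)
  have hw : HasFDerivAt (fun y ↦ f y w) ((fderiv ℝ f x).flip w) x := by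
    simpa using hfd.clm_apply (hasFDerivAt_const w x)
  have hs := hasFDerivAt_bilin_apply₂ hv hw
  have hG1 : HasFDerivAt (fun y ↦ G y v) ((fderiv ℝ G x).flip v) x := by
    simpa using hGd.clm_apply (hasFDerivAt_const v x)
  have hG2 : HasFDerivAt (fun y ↦ G y v w) (((fderiv ℝ G x).flip v).flip w) x := by
    simpa using hG1.clm_apply (hasFDerivAt_const w x)
  have heq : (fun y ↦ G y v w) = fun y ↦ Minkowski.bilin (f y v) (f y w) := by
    funext y; simp [hG, -Minkowski.bilin_apply]
  rw [heq] at hG2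
  have key := congrArg (fun φ : E4 →L[ℝ] ℝ ↦ φ u) (hG2.unique hs)
  simp only [ContinuousLinearMap.flip_apply, add_apply, ContinuousLinearMap.comp_apply] at key
  rw [key, add_comm]

/-! ### The Christoffel identity -/

/-- Values of a trilinear map are bounded by its operator norm. [folklore] -/
theorem abs_apply₃_le (Φ : E4 →L[ℝ] E4 →L[ℝ] E4 →L[ℝ] ℝ) {δ : ℝ} (hδ : ‖Φ‖ ≤ δ) (a b c : E4) :
    |Φ a b c| ≤ δ * ‖a‖ * ‖b‖ * ‖c‖ := by
  rw [← Real.norm_eq_abs]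
  exact (Φ a b).le_of_opNorm_le ((Φ a).le_of_opNorm_le (Φ.le_of_opNorm_le hδ a) b) c

/-- **The Christoffel identity, quantitative.** If `f` is `C¹` at `x` with SYMMETRIC derivative
`Df(x)(u)(v) = Df(x)(v)(u)` (e.g. `f = Dψ`, `ψ ∈ C²`) and `‖D(η(f·, f·))(x)‖ ≤ δ`, then
`|η(Df(x)(u)(v), f(x)w)| ≤ (3/2) δ ‖u‖ ‖v‖ ‖w‖`: indeed
`2η(Df(u)(v), f w) = Dg(u)(v,w) + Dg(v)(u,w) − Dg(w)(u,v)`. [folklore] -/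
theorem abs_bilin_fderiv_apply_le {f : E4 → E4 →L[ℝ] E4} {x : E4} {δ : ℝ}
    (hf : ContDiffAt ℝ 1 f x) (hsymm : ∀ u v, fderiv ℝ f x u v = fderiv ℝ f x v u)
    (hδ : ‖fderiv ℝ (fun y ↦ Minkowski.bilin.bilinearComp (f y) (f y)) x‖ ≤ δ) (u v w : E4) :
    |Minkowski.bilin (fderiv ℝ f x u v) (f x w)| ≤ 3 / 2 * δ * ‖u‖ * ‖v‖ * ‖w‖ := by
  set Φ := fderiv ℝ (fun y ↦ Minkowski.bilin.bilinearComp (f y) (f y)) x with hΦ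
  have e1 := fderiv_bilinearComp_self_apply hf u v w
  have e2 := fderiv_bilinearComp_self_apply hf v u w
  have e3 := fderiv_bilinearComp_self_apply hf w u v
  have key : 2 * Minkowski.bilin (fderiv ℝ f x u v) (f x w) = Φ u v w + Φ v u w - Φ w u v := by
    rw [e1, e2, e3, hsymm v u, hsymm w u, hsymm w v,
      Minkowski.bilin_symm (f x v) (fderiv ℝ f x u w),
      Minkowski.bilin_symm (f x u) (fderiv ℝ f x v w)]
    ring
  have h1 := abs_apply₃_le Φ hδ u v w
  have h2 := abs_apply₃_le Φ hδ v u w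
  have h3 := abs_apply₃_le Φ hδ w u v
  have h4 : |Φ u v w + Φ v u w - Φ w u v| ≤ |Φ u v w| + |Φ v u w| + |Φ w u v| :=
    (abs_sub _ _).trans (add_le_add (abs_add_le _ _) le_rfl)
  have h5 : |2 * Minkowski.bilin (fderiv ℝ f x u v) (f x w)| =
      2 * |Minkowski.bilin (fderiv ℝ f x u v) (f x w)| := by
    rw [abs_mul, abs_two]
  rw [key] at h5
  nlinarith [h1, h2, h3, h4, h5, mul_comm ‖u‖ ‖v‖, norm_nonneg u, norm_nonneg v, norm_nonneg w]

/-! ### The second-derivative bound -/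

/-- **Second derivatives are controlled by first derivatives of the pulled-back metric.** If
`ψ` is `C²` at `x`, `‖Dψ(x)‖ ≤ Γ`, `‖η(Dψ(x)·, Dψ(x)·) − η‖ ≤ ε ≤ 1/2` and
`‖D(y ↦ η(Dψ(y)·, Dψ(y)·))(x)‖ ≤ δ`, then `‖D²ψ(x)‖ ≤ 3Γδ`. [folklore] -/
theorem norm_fderiv_fderiv_le {ψ : E4 → E4} {x : E4} {Γ ε δ : ℝ} (hψ : ContDiffAt ℝ 2 ψ x)
    (hΓ : ‖fderiv ℝ ψ x‖ ≤ Γ)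
    (hε : ‖Minkowski.bilin.bilinearComp (fderiv ℝ ψ x) (fderiv ℝ ψ x) - Minkowski.bilin‖ ≤ ε)
    (hε2 : ε ≤ 1 / 2)
    (hδ : ‖fderiv ℝ (fun y ↦ Minkowski.bilin.bilinearComp (fderiv ℝ ψ y) (fderiv ℝ ψ y)) x‖ ≤ δ) :
    ‖fderiv ℝ (fderiv ℝ ψ) x‖ ≤ 3 * Γ * δ := by
  have hf : ContDiffAt ℝ 1 (fderiv ℝ ψ) x := hψ.fderiv_right (by norm_num)
  have hsymm : ∀ u v, fderiv ℝ (fderiv ℝ ψ) x u v = fderiv ℝ (fderiv ℝ ψ) x v u :=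
    fun u v ↦ hψ.isSymmSndFDerivAt (by simp) u v
  have hδ0 : 0 ≤ δ :=
    (norm_nonneg (fderiv ℝ (fun y ↦ Minkowski.bilin.bilinearComp (fderiv ℝ ψ y)
      (fderiv ℝ ψ y)) x)).trans hδ
  have hΓ0 : 0 ≤ Γ := (norm_nonneg (fderiv ℝ ψ x)).trans hΓ
  refine ContinuousLinearMap.opNorm_le_bound₂ _ (by positivity) fun u v ↦ ?_
  set z : E4 := fderiv ℝ (fderiv ℝ ψ) x u v with hz
  obtain ⟨w, hw, hwn⟩ := exists_preimage_norm_le hΓ hε (by linarith) (timeReflect z)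
  rw [norm_timeReflect] at hwn
  have h1 : ‖z‖ ^ 2 = Minkowski.bilin z (fderiv ℝ ψ x w) := by rw [hw, bilin_self_timeReflect]
  have h2 : |Minkowski.bilin z (fderiv ℝ ψ x w)| ≤ 3 / 2 * δ * ‖u‖ * ‖v‖ * ‖w‖ :=
    abs_bilin_fderiv_apply_le hf hsymm hδ u v w
  have h3 : ‖w‖ ≤ 2 * Γ * ‖z‖ := by nlinarith [norm_nonneg w, norm_nonneg z]
  have h4 : ‖z‖ ^ 2 ≤ (3 * Γ * δ * ‖u‖ * ‖v‖) * ‖z‖ := by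
    calc ‖z‖ ^ 2 ≤ |Minkowski.bilin z (fderiv ℝ ψ x w)| := h1 ▸ le_abs_self _
      _ ≤ 3 / 2 * δ * ‖u‖ * ‖v‖ * ‖w‖ := h2
      _ ≤ 3 / 2 * δ * ‖u‖ * ‖v‖ * (2 * Γ * ‖z‖) := by gcongr
      _ = (3 * Γ * δ * ‖u‖ * ‖v‖) * ‖z‖ := by ring
  by_cases hz0 : ‖z‖ = 0
  · rw [hz0]; positivity
  · rw [sq] at h4
    exact le_of_mul_le_mul_right h4 (lt_of_le_of_ne (norm_nonneg z) (Ne.symm hz0))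

end AnnulusRigidity

/-- Registered sub-goal form (stub `annulusRigidity_norm_fderiv_fderiv_le` of the crux item, helper for `stub_annulusRigidity`) of
`AnnulusRigidity.norm_fderiv_fderiv_le`: the second-derivative bound `‖D²ψ(x)‖ ≤ 3Γδ` from the Christoffel identity. [folklore] -/
theorem annulusRigidity_norm_fderiv_fderiv_le : open Literature.Geometry.Lorentzian in ∀ {ψ : E4 → E4} {x : E4} {Γ ε δ : ℝ}, ContDiffAt ℝ 2 ψ x → ‖fderiv ℝ ψ x‖ ≤ Γ → ‖Minkowski.bilin.bilinearComp (fderiv ℝ ψ x) (fderiv ℝ ψ x) - Minkowski.bilin‖ ≤ ε → ε ≤ 1 / 2 → ‖fderiv ℝ (fun y ↦ Minkowski.bilin.bilinearComp (fderiv ℝ ψ y) (fderiv ℝ ψ y)) x‖ ≤ δ → ‖fderiv ℝ (fderiv ℝ ψ) x‖ ≤ 3 * Γ * δ :=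
  fun hψ hΓ hε hε2 hδ ↦ AnnulusRigidity.norm_fderiv_fderiv_le hψ hΓ hε hε2 hδ

end Summit.FinalStateConjecture.FinalStateConjecture.Theorems

end
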